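import Summits.Ventures.HSemireg.WedgeMixedBox
import Summits.Ventures.HSemireg.WedgeHankelGlue
import Summits.Ventures.HSemireg.WedgePairShear

/-!
# Venture HSemireg — THE HANKEL BOX LAW: THEOREM H (C15) × THEOREM K, uniform in the number `n` of factors, their
# dimensions `m_i` and their classes `v_i ∈ K[Θ_i]`: `rank(θ ↦ θ ∧ (v₀ ∧ ⋯ ∧ v_{n−1}) ∣ ⋀^k) = [t^k] Π_i H_{m_i}(q_i)(t)`

HONEST FRAMING. Part of the Lean index of the computation cell `pub-hsemireg` (seat p10 gen 10, Sunday typer «UNIFORM-IN-n»).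
Finite-dimensional EXTERIOR ALGEBRA over a field and ranks of HANKEL MATRICES ONLY: no variety, no cohomology theory, no
sheaf, no Ext group and no semiregularity map is constructed here; nothing here says that HC / HC_CM / HC_AV holds; no
Literature fact is declared or used.  Custodian versions cited: theory/FORMULA-N.md PART A §2.3 THEOREM K («rank polynomials
MULTIPLY»), §2.6 THEOREM H («rank(⌟v ∣ HT^k(X)) = C(n,k)·rank H_k(v)», the HANKEL / catalecticant LAW, Kronecker dictionary
ρ = 1 pure / ρ = 2 transverse pair / ρ = 3 generic), §7 FN-1 («for every n ≥ 1 and every pair of … transverse-pair Chern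
characters»), FN-4; PART B §N.3 / §N.5 / §N.8 (th-7); STRUCTURE.md v1.0-SIGNED 9b196a05977dd067 §1.1 C15 (HANKEL LAW) and the
FORMULA-N Σ2 line («P_box = Π P_factors»).  The dictionary (a class `v = Σ_j q_j Θ^j/j! ∈ K[Θ]` on an abelian `m`-fold ↦ th-7's
Hankel class `w_m(q) = Σ_j q_j E_j ∈ ⋀^m K^{2m}`; contraction `⌟(v₀ ⊠ ⋯ ⊠ v_{n−1})` on `HT^k(X₀ × ⋯ × X_{n−1})` ↦ `θ ↦ θ ∧ (w₀ ∧ ⋯ ∧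
w_{n−1})`, sign-blind) is QUOTED from those files, never asserted.

WHAT IS IN THE TREE.  THEOREM H on ONE factor (`WedgeHankelModel.hankelLaw_model`, th-7: `dim range(θ ↦ θ ∧ w_m(q) ∣ ⋀^k K^{2m}) =
C(m,k)·rank H_k(q)`, every field, every `m, k, q`); THEOREM K over ANY finite splitting (`WedgeMixedBox.rankPoly_prodR`, gen 6) and
the MIXED BOX of th-7's POINT PAIRS `a·E_{X_i} + c·E_{Y_i}` (`WedgeMixedBox.rankPoly_mixedBox = Π_i P_{m_i}`, ONE coefficient pair
`(a, c)` for all factors); the transverse pair on ONE factor (`WedgePairShear.transversePairLawAt`, th-7's shear); the two-factor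
degree-2 Hankel box on the real carriers (`ContractionRankHankelBox`, p4).  THIS FILE composes H and K once and for all:
* §1 **THEOREM H IN RANK-POLYNOMIAL FORM**: the HANKEL RANK POLYNOMIAL `hankelPoly m q = H_m(q)(t) := Σ_j C(m,j)·rank H_j(q)·t^j`
  (`H_j(q) = (q_{i+s})_{i ≤ j, s ≤ m−j}` = `WedgeHankelModel.hankel1`) IS the rank polynomial of `w_m(q)` on its `2m` generators
  (**`rankPoly_w`**; no hypothesis on `m` or `q`).
* §2 **THE HANKEL BOX LAW** (uniform in `n`, in the dimensions `m : Fin n → ℕ` and in the sequences `q : Fin n → (ℕ → K)`; every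
  field): on the mixed model `Σₗ i, Fin (m_i + m_i)` of gen 6, with `v_i = w_{m_i}(q_i)` embedded in block `i` (`hfac`) and
  `F = v₀ ∧ ⋯ ∧ v_{n−1}` (`hankelBox`): **`rankPoly_hankelBox_fin`: `rankPoly(F) = Π_i H_{m_i}(q_i)`**, i.e.
  **`finrank_range_wedge_hankelBox`: `rank(θ ↦ θ ∧ F ∣ ⋀^k) = [t^k] Π_i H_{m_i}(q_i)(t)`** for every `n ≥ 1` and every `k`, with
  NO hypothesis on the `m_i` or the `q_i`; kernel by rank–nullity **`finrank_ker_wedge_hankelBox`: `dim ker = C(Σ_i 2m_i, k) − [t^k] Π_i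
  H_{m_i}(q_i)`**.  (In the quoted dictionary: the `HT`-side rank of contraction against `ch` of an external product of ARBITRARY
  `K[Θ_i]`-class objects — line bundles, points, secant and tangent objects, anything of Hankel rank ρ — is the product of the
  factors' Hankel polynomials; FN-1 / the mixed box is the case «every factor of Hankel rank 2».)
* §3 **THE RANK-2 INSTANCES, TRANSPORTED (no new rank computation)**: th-7's reindexing isomorphisms of THEOREM T's and THEOREM H's
  glue files are ONE map (`Φ_pair_eq_Φ`, `rfl`), so (i) **`w_ppSeq`: the Hankel class of the two-ended sequence `(a,0,…,0,c)` IS th-7's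
  point pair `a·E_X + c·E_Y`**, hence `hankelPoly m (a,0,…,0,c) = P_m` (`hankelPoly_ppSeq`, `a, c ≠ 0`, `m ≥ 1`) and — read
  backwards — the exterior algebra COMPUTES the two-ended Hankel ranks (`choose_mul_rank_hankel1_ppSeq`; cf. `WedgeC15General.
  hankel1_rank_twoEnded` by column bookkeeping); (ii) **`hankelPoly_tpSeq`: the Hankel rank polynomial of a TRANSVERSE PAIR
  `q_j = Aλ^j + Bμ^j` (`λ ≠ μ`, `A, B ≠ 0`, `m ≥ 1`) is `P_m`** (th-7's shear theorem transported along `Φ`), and backwards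
  **`rank_hankel1_tpSeq`: a two-exponential Hankel matrix `(Aλ^{i+s} + Bμ^{i+s})` with ≥ 2 rows and ≥ 2 columns has rank EXACTLY 2**
  (C15's Kronecker dictionary, direction «two exponentials ⇒ ρ = 2», obtained from the wedge model, not from determinants).
* §4 **THE RANK-2 BOXES, UNIFORM IN `n`**: **`finrank_range_wedge_hankelBox_tpSeq`: for transverse-pair factors with ARBITRARY
  per-factor data `(A_i, B_i, λ_i ≠ μ_i)`, `rank(θ ↦ θ ∧ F ∣ ⋀^k) = [t^k] Π_i P_{m_i}(t)`** (FN-1's class side AS WORDED: «every …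
  transverse-pair Chern characters», every `n`, every dimensions; in `ℤ[X]` with th-6's `P`: `…_eq_coeff_P`);
  **`finrank_range_wedge_hankelBox_ppSeq`: point pairs with PER-FACTOR coefficient pairs `(a_i, c_i)`** (READ-NOTE-p10-g8 «NOT typed:
  general coefficient pairs» — closed here for the iterated/mixed model); and **`hankelBox_ppSeq_eq_mixedBox`: with one pair `(a, c)`
  the Hankel box of two-ended sequences IS gen 6's `mixedBox` on the nose**, so `rankPoly_mixedBox` is the instance «all Hankel
  ranks 2» of §2.  Any MIXTURE of factor types is covered by §2 with `q_i` chosen per factor.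
NOT typed here: the Hankel-rank-1 («pure», `(1+t)^m`) and rank-≥ 3 closed forms of `H_m(q)` (they enter §2 by value through
`hankel1 … .rank`); per-q / kernel-NAME refinements of the Hankel box; anything Ext-side.  Class side only.
Namespace `Summit.Ventures.HSemireg.Wedge.HankelBox` (new); new names only.
-/

open Module Polynomial

namespace Summit.Ventures.HSemireg.Wedge.HankelBox

open Summit.Ventures.HSemireg.Wedge Summit.Ventures.HSemireg.Wedge.Kunneth Summit.Ventures.HSemireg.Wedge.MixedBox

variable (K : Type*) [Field K]

/-! ## §1. One factor: the HANKEL RANK POLYNOMIAL `H_m(q)(t) = Σ_j C(m,j)·rank H_j(q)·t^j` -/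

/-- the HANKEL RANK POLYNOMIAL of a coefficient sequence `q` on an `m`-dimensional factor:
`H_m(q)(t) := Σ_{j ≤ m} C(m,j) · rank (q_{i+s})_{i ≤ j, s ≤ m−j} · t^j` (FORMULA-N PART A §2.6 THEOREM H / STRUCTURE C15). -/
noncomputable def hankelPoly (m : ℕ) (q : ℕ → K) : Polynomial ℕ :=
  ∑ j ∈ Finset.range (m + 1), monomial j (m.choose j * (Hankel.hankel1 K m j q).rank)

/-- coefficients of the Hankel rank polynomial: `[t^k] H_m(q) = C(m,k)·rank H_k(q)` for EVERY `k` (both sides `0` for `k > m`). -/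
lemma coeff_hankelPoly (m : ℕ) (q : ℕ → K) (k : ℕ) :
    (hankelPoly K m q).coeff k = m.choose k * (Hankel.hankel1 K m k q).rank := by
  rw [hankelPoly, finsetSum_coeff]
  simp_rw [coeff_monomial]
  rw [Finset.sum_ite_eq']
  split_ifs with h
  · rfl
  · rw [Finset.mem_range, not_lt] at h
    rw [Nat.choose_eq_zero_of_lt (by omega), zero_mul]

/-- the two spellings of `θ ↦ θ ∧ x` on `⋀^k K^{2m}` (THEOREM H's file and THEOREM K's file) are one map. -/
lemma hankel_wedge_eq (m k : ℕ) (x : HT K (Hankel.In m)) :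
    Hankel.wedge K m k x = Kunneth.wedge K (Hankel.In m) k x := rfl

/-- th-7's Hankel class `w_m(q) = Σ_j q_j E_j` on all `2m` generators is homogeneous of degree `m`. -/
lemma w_mem_Hom_univ (m : ℕ) (q : ℕ → K) : Hankel.w K m m q ∈ Hom K (Hankel.In m) Finset.univ m := by
  have h := Hankel.w_mem_Hom K (n := m) le_rfl q
  rwa [Hankel.Dm_top] at h

/-- **THEOREM H IN RANK-POLYNOMIAL FORM**: the rank polynomial of the Hankel class `w_m(q)` on its `2m` generators IS the
Hankel rank polynomial `H_m(q)` — every field, every `m`, every sequence `q` (th-7's `hankelLaw_model`, coefficientwise). -/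
theorem rankPoly_w (m : ℕ) (q : ℕ → K) :
    rankPoly K (Hankel.In m) Finset.univ (Hankel.w K m m q) = hankelPoly K m q := by
  ext k
  rw [coeff_rankPoly, V_univ, coeff_hankelPoly, ← hankel_wedge_eq]
  exact Hankel.hankelLaw_model K k q

/-! ## §2. THE HANKEL BOX LAW on the mixed model `Σₗ i, Fin (m_i + m_i)` -/

section Box

variable {n : ℕ} (m : Fin n → ℕ)

/-- factor `i`'s Hankel class `v_i = w_{m_i}(q_i) = Σ_j (q_i)_j E_j` (dimension `m i`), embedded into block `i` of gen 6's mixed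
model along `facEmb m i` (`1` for `i ≥ n`). -/
noncomputable def hfac (q : Fin n → ℕ → K) (i : ℕ) : HT K (Gen m) :=
  if h : i < n then emb K (facEmb m ⟨i, h⟩) (Hankel.w K (m ⟨i, h⟩) (m ⟨i, h⟩) (q ⟨i, h⟩)) else 1

/-- factor `i < n` is homogeneous of degree `m i` on block `i`. -/
lemma hfac_mem_Hom (q : Fin n → ℕ → K) {i : ℕ} (hi : i < n) :
    hfac K m q i ∈ Hom K (Gen m) (blk m i) (m ⟨i, hi⟩) := by
  rw [hfac, dif_pos hi, blk, dif_pos hi]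
  exact emb_mem_Hom K _ (w_mem_Hom_univ K _ _)

/-- **factor `i`'s rank polynomial on its block is its Hankel rank polynomial `H_{m_i}(q_i)`** (THEOREM H glued by
`finrank_V_emb`; NO hypothesis on `m i` or on `q i`). -/
theorem rankPoly_hfac (q : Fin n → ℕ → K) {i : ℕ} (hi : i < n) :
    rankPoly K (Gen m) (blk m i) (hfac K m q i) = hankelPoly K (m ⟨i, hi⟩) (q ⟨i, hi⟩) := by
  ext k
  rw [coeff_rankPoly, hfac, dif_pos hi, blk, dif_pos hi, finrank_V_emb, coeff_hankelPoly, ← hankel_wedge_eq]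
  exact Hankel.hankelLaw_model K k _

/-- **THE HANKEL BOX `F = v₀ ∧ ⋯ ∧ v_{n−1}`** of the embedded Hankel classes `v_i = w_{m_i}(q_i)` (model of `ch` of an external
product of `K[Θ_i]`-class objects on `Y = X₀ × ⋯ × X_{n−1}`, `dim X_i = m_i`, sign-blind; QUOTED dictionary). -/
noncomputable def hankelBox (q : Fin n → ℕ → K) : HT K (Gen m) := prodR K (hfac K m q) n

/-- THEOREM K for the Hankel box, raw form: `rankPoly(F) = Π_{i<n} rankPoly_{block i}(v_i)` (the blocks cover the generators;
`DecidableEq` on the `Σₗ` generators from the linear order, as in gen 6's `rankPoly_mixedBox_raw` — hence the `convert`). -/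
theorem rankPoly_hankelBox_raw (hn : 1 ≤ n) (q : Fin n → ℕ → K) :
    rankPoly K (Gen m) Finset.univ (hankelBox K m q) =
      ∏ i ∈ Finset.range n, rankPoly K (Gen m) (blk m i) (hfac K m q i) := by
  have h := (rankPoly_prodR K (f := hfac K m q) (d := fun i => if h : i < n then m ⟨i, h⟩ else 0)
    (fun i hi => by rw [dif_pos hi]; exact hfac_mem_Hom K m q hi) (blk_disjoint m) n hn le_rfl).2
  rw [hankelBox]
  convert h using 2
  ext x
  simp only [Finset.mem_univ, Finset.mem_biUnion, Finset.mem_range, true_iff]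
  exact ⟨(ofLex x).1, (ofLex x).1.2, (mem_blk m (ofLex x).1.2).mpr rfl⟩

/-- **THE HANKEL BOX LAW: `rankPoly(F) = Π_{i<n} H_{m_i}(q_i)`** (`n ≥ 1`; NO hypothesis on the dimensions or the sequences). -/
theorem rankPoly_hankelBox (hn : 1 ≤ n) (q : Fin n → ℕ → K) :
    rankPoly K (Gen m) Finset.univ (hankelBox K m q) =
      ∏ i ∈ Finset.range n, if h : i < n then hankelPoly K (m ⟨i, h⟩) (q ⟨i, h⟩) else 1 := by
  rw [rankPoly_hankelBox_raw K m hn q]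
  refine Finset.prod_congr rfl fun i hi => ?_
  have hi' : i < n := Finset.mem_range.mp hi
  rw [dif_pos hi', rankPoly_hfac K m q hi']

/-- the same product written over `Fin n`: **`rankPoly(F) = Π_{i : Fin n} H_{m_i}(q_i)`**. -/
theorem rankPoly_hankelBox_fin (hn : 1 ≤ n) (q : Fin n → ℕ → K) :
    rankPoly K (Gen m) Finset.univ (hankelBox K m q) = ∏ i : Fin n, hankelPoly K (m i) (q i) := by
  rw [rankPoly_hankelBox K m hn q,
    ← Fin.prod_univ_eq_prod_range (fun i => if h : i < n then hankelPoly K (m ⟨i, h⟩) (q ⟨i, h⟩) else 1)]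
  refine Finset.prod_congr rfl fun i _ => ?_
  rw [dif_pos i.2]

/-- **`rank(θ ↦ θ ∧ F ∣ ⋀^k) = [t^k] Π_i H_{m_i}(q_i)(t)`** for the Hankel box — every field, every `n ≥ 1`, every dimensions
`m_i`, every coefficient sequences `q_i`, every degree `k` (THEOREM H × THEOREM K, uniform in `n`). -/
theorem finrank_range_wedge_hankelBox (hn : 1 ≤ n) (q : Fin n → ℕ → K) (k : ℕ) :
    finrank K (LinearMap.range (wedge K (Gen m) k (hankelBox K m q))) = (∏ i : Fin n, hankelPoly K (m i) (q i)).coeff k := by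
  rw [← V_univ, ← coeff_rankPoly, rankPoly_hankelBox_fin K m hn q]

/-- the mixed model has `Σ_i 2 m_i` generators. -/
lemma card_Gen : Fintype.card (Gen m) = ∑ i : Fin n, (m i + m i) := by
  rw [show Fintype.card (Gen m) = Fintype.card (Σ i : Fin n, Fin (m i + m i)) from rfl, Fintype.card_sigma]
  simp only [Fintype.card_fin]

/-- `dim ⋀^k K^{Σ_i 2m_i} = C(Σ_i 2m_i, k)`. -/
lemma finrank_exteriorPower_Gen (k : ℕ) :
    finrank K (⋀[K]^k (Gen m → K)) = (∑ i : Fin n, (m i + m i)).choose k := by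
  rw [exteriorPower.finrank_eq, finrank_fintype_fun_eq_card, card_Gen]

/-- **KERNEL of the Hankel box by rank–nullity: `dim ker(θ ↦ θ ∧ F ∣ ⋀^k) = C(Σ_i 2m_i, k) − [t^k] Π_i H_{m_i}(q_i)`.** -/
theorem finrank_ker_wedge_hankelBox (hn : 1 ≤ n) (q : Fin n → ℕ → K) (k : ℕ) :
    finrank K (LinearMap.ker (wedge K (Gen m) k (hankelBox K m q))) =
      (∑ i : Fin n, (m i + m i)).choose k - (∏ i : Fin n, hankelPoly K (m i) (q i)).coeff k := by
  have h := LinearMap.finrank_range_add_finrank_ker (wedge K (Gen m) k (hankelBox K m q))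
  rw [finrank_range_wedge_hankelBox K m hn q k, finrank_exteriorPower_Gen] at h
  omega

/-- in particular **the rank never exceeds `C(Σ_i 2m_i, k)`** and `rank + ker = C(Σ_i 2m_i, k)` (bookkeeping form). -/
theorem finrank_range_add_finrank_ker_wedge_hankelBox (hn : 1 ≤ n) (q : Fin n → ℕ → K) (k : ℕ) :
    (∏ i : Fin n, hankelPoly K (m i) (q i)).coeff k + finrank K (LinearMap.ker (wedge K (Gen m) k (hankelBox K m q))) =
      (∑ i : Fin n, (m i + m i)).choose k := by
  rw [← finrank_range_wedge_hankelBox K m hn q k, ← finrank_exteriorPower_Gen K m k]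
  exact LinearMap.finrank_range_add_finrank_ker _

end Box

/-! ## §3. The rank-2 instances on ONE factor, transported along th-7's reindexing `Φ` (no new rank computation) -/

section RankTwo

variable (m : ℕ)

/-- the coefficient sequence of a TRANSVERSE PAIR `A·exp(λΘ) + B·exp(μΘ)`: `q_j = A λ^j + B μ^j`. -/
def tpSeq (A B lam mu : K) : ℕ → K := fun j => A * lam ^ j + B * mu ^ j

/-- the TWO-ENDED sequence of th-7's point pair `a·1 + c·pt`: `q = (a, 0, …, 0, c)`. -/
def ppSeq (a c : K) : ℕ → K := fun j => (if j = 0 then a else 0) + (if j = m then c else 0)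

/-- values of the transverse-pair sequence. -/
@[simp] lemma tpSeq_apply (A B lam mu : K) (j : ℕ) : tpSeq K A B lam mu j = A * lam ^ j + B * mu ^ j := rfl

/-- values of the two-ended sequence. -/
@[simp] lemma ppSeq_apply (a c : K) (j : ℕ) :
    ppSeq K m a c j = (if j = 0 then a else 0) + (if j = m then c else 0) := rfl

/-- ranks transported along th-7's reindexing `Φ : ⋀(K^{Fin m ⊕ Fin m}) ≃ₐ ⋀(K^{Fin (m+m)})`: th-6's `wedgeWith k q` and
`θ ↦ θ ∧ w_m(q)` on `⋀^k` have the same rank (THEOREM H's glue, `Φ (vClass q) = w_m(q)`). -/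
lemma finrank_range_wedge_w_eq_wedgeWith (k : ℕ) (q : ℕ → K) :
    finrank K (LinearMap.range (Kunneth.wedge K (Hankel.In m) k (Hankel.w K m m q))) =
      finrank K (LinearMap.range (FormulaN.wedgeWith K m k q)) := by
  rw [← hankel_wedge_eq, ← Hankel.Φ_vClass K m q, ← Hankel.map_Φ_range_wedgeWith K m k q]
  exact LinearEquiv.finrank_map_eq (Hankel.Φ K m).toLinearEquiv _

/-- **TRANSVERSE PAIR, rank form on `w`** (THEOREM T by th-7's shear, transported): for `m ≥ 1`, `k ≤ m`, `λ ≠ μ`, `A, B ≠ 0`,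
`rank(θ ↦ θ ∧ w_m(Aλ^j + Bμ^j) ∣ ⋀^k) = 2C(m,k) − [k = 0] − [k = m]`. -/
theorem finrank_range_wedge_w_tpSeq (hm : 1 ≤ m) {k : ℕ} (hk : k ≤ m) {A B lam mu : K} (hlm : lam ≠ mu)
    (hA : A ≠ 0) (hB : B ≠ 0) :
    finrank K (LinearMap.range (Kunneth.wedge K (Hankel.In m) k (Hankel.w K m m (tpSeq K A B lam mu)))) =
      WedgePair.pointPairRank m k := by
  rw [finrank_range_wedge_w_eq_wedgeWith]
  exact WedgePairGlue.transversePairLawAt K m hm hk A B lam mu hlm hA hB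

/-- **the Hankel rank polynomial of a TRANSVERSE PAIR is `P_m = 2(1+t)^m − 1 − t^m`** (`m ≥ 1`, `λ ≠ μ`, `A, B ≠ 0`):
Hankel rank 2 in the middle, 1 at the two ends (C15's Kronecker dictionary, ρ = 2). -/
theorem hankelPoly_tpSeq (hm : 1 ≤ m) {A B lam mu : K} (hlm : lam ≠ mu) (hA : A ≠ 0) (hB : B ≠ 0) :
    hankelPoly K m (tpSeq K A B lam mu) = PairPowers.pairPoly m := by
  rw [← rankPoly_w]
  ext k
  rw [coeff_rankPoly, V_univ, PairPowers.coeff_pairPoly]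
  split_ifs with hk
  · exact finrank_range_wedge_w_tpSeq K m hm hk hlm hA hB
  · rw [← hankel_wedge_eq, Hankel.hankelLaw_model, Nat.choose_eq_zero_of_lt (by omega), zero_mul]

/-- read backwards, **the wedge model COMPUTES two-exponential Hankel ranks**: `C(m,k)·rank (Aλ^{i+s} + Bμ^{i+s})_{i ≤ k, s ≤ m−k}
= 2C(m,k) − [k = 0] − [k = m]` for `k ≤ m` (`m ≥ 1`, `λ ≠ μ`, `A, B ≠ 0`). -/
theorem choose_mul_rank_hankel1_tpSeq (hm : 1 ≤ m) {A B lam mu : K} (hlm : lam ≠ mu) (hA : A ≠ 0) (hB : B ≠ 0)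
    {k : ℕ} (hk : k ≤ m) :
    m.choose k * (Hankel.hankel1 K m k (tpSeq K A B lam mu)).rank = WedgePair.pointPairRank m k := by
  rw [← coeff_hankelPoly, hankelPoly_tpSeq K m hm hlm hA hB, PairPowers.coeff_pairPoly, if_pos hk]

/-- **C15's dictionary, direction «two exponentials ⇒ ρ = 2», as a theorem about Hankel matrices**: for `0 < k < m`, `λ ≠ μ`,
`A, B ≠ 0` the Hankel matrix `(Aλ^{i+s} + Bμ^{i+s})_{i ≤ k, s ≤ m−k}` has rank EXACTLY `2` (from the exterior algebra, via THEOREM T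
and THEOREM H — not from minors). -/
theorem rank_hankel1_tpSeq (hm : 1 ≤ m) {A B lam mu : K} (hlm : lam ≠ mu) (hA : A ≠ 0) (hB : B ≠ 0)
    {k : ℕ} (hk0 : 0 < k) (hkm : k < m) :
    (Hankel.hankel1 K m k (tpSeq K A B lam mu)).rank = 2 := by
  have h := choose_mul_rank_hankel1_tpSeq K m hm hlm hA hB hkm.le
  rw [WedgePair.pointPairRank, if_neg (by omega), if_neg (by omega), Nat.sub_zero, Nat.sub_zero, mul_comm 2] at h
  exact Nat.eq_of_mul_eq_mul_left (Nat.choose_pos hkm.le) h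

/-- th-7's two reindexing isomorphisms `⋀(K^{Fin m ⊕ Fin m}) ≃ₐ ⋀(K^{Fin (m+m)})` — THEOREM T's glue (`WedgePairGlue.Φ`) and
THEOREM H's glue (`Hankel.Φ`) — are the same map. -/
lemma Φ_pair_eq_Φ : WedgePairGlue.Φ K m = Hankel.Φ K m := rfl

/-- **THE HANKEL CLASS OF THE TWO-ENDED SEQUENCE IS th-7's POINT PAIR**: `w_m(a, 0, …, 0, c) = a·E_X + c·E_Y` (`m ≥ 1`). -/
theorem w_ppSeq (hm : 1 ≤ m) (a c : K) : Hankel.w K m m (ppSeq K m a c) = PairPowers.pp K m a c := by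
  rw [← Hankel.Φ_vClass, ← Φ_pair_eq_Φ]
  exact WedgePairGlue.Φ_vClass_pointPair K m hm a c

/-- hence **the Hankel rank polynomial of the two-ended sequence is `P_m`** (`m ≥ 1`, `a, c ≠ 0`; THEOREM T for the point pair,
th-7's `finrank_range_wedgeMap_pointPair`, coefficientwise). -/
theorem hankelPoly_ppSeq (hm : 1 ≤ m) {a c : K} (ha : a ≠ 0) (hc : c ≠ 0) :
    hankelPoly K m (ppSeq K m a c) = PairPowers.pairPoly m := by
  rw [← rankPoly_w, w_ppSeq K m hm]
  ext k
  rw [coeff_rankPoly, V_univ, PairPowers.coeff_pairPoly]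
  split_ifs with hk
  · exact WedgePair.finrank_range_wedgeMap_pointPair K (by omega) hk ha hc
  · rw [PairPowers.range_wedge_pp_eq_bot K (by omega), finrank_bot]

/-- read backwards, **the wedge model COMPUTES the two-ended Hankel ranks**: `C(m,k)·rank H_k(a,0,…,0,c) = 2C(m,k) − [k=0] − [k=m]`
for `k ≤ m` (`m ≥ 1`, `a, c ≠ 0`; cf. `WedgeC15General.hankel1_rank_twoEnded`, rank `2` for `0 < k < m` by column bookkeeping). -/
theorem choose_mul_rank_hankel1_ppSeq (hm : 1 ≤ m) {a c : K} (ha : a ≠ 0) (hc : c ≠ 0) {k : ℕ} (hk : k ≤ m) :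
    m.choose k * (Hankel.hankel1 K m k (ppSeq K m a c)).rank = WedgePair.pointPairRank m k := by
  rw [← coeff_hankelPoly, hankelPoly_ppSeq K m hm ha hc, PairPowers.coeff_pairPoly, if_pos hk]

end RankTwo

/-! ## §4. The rank-2 BOXES, uniform in `n`: transverse pairs with per-factor data; point pairs with per-factor coefficients -/

section RankTwoBoxes

variable {n : ℕ} (m : Fin n → ℕ)

/-- **THE TRANSVERSE-PAIR BOX, UNIFORM IN `n`** (FN-1's class side for ARBITRARY transverse-pair factors): factors of dimensions
`m_i ≥ 1` carrying `A_i exp(λ_iΘ_i) + B_i exp(μ_iΘ_i)` with `λ_i ≠ μ_i`, `A_i, B_i ≠ 0` (all data per factor):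
`rank(θ ↦ θ ∧ F ∣ ⋀^k) = [t^k] Π_i P_{m_i}(t)` — every field, every `n ≥ 1`, every `k`. -/
theorem finrank_range_wedge_hankelBox_tpSeq (hn : 1 ≤ n) (hm : ∀ i, 1 ≤ m i) {A B lam mu : Fin n → K}
    (hlm : ∀ i, lam i ≠ mu i) (hA : ∀ i, A i ≠ 0) (hB : ∀ i, B i ≠ 0) (k : ℕ) :
    finrank K (LinearMap.range (wedge K (Gen m) k (hankelBox K m fun i => tpSeq K (A i) (B i) (lam i) (mu i)))) =
      (∏ i : Fin n, PairPowers.pairPoly (m i)).coeff k := by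
  rw [finrank_range_wedge_hankelBox K m hn _ k,
    Finset.prod_congr rfl fun i _ => hankelPoly_tpSeq K (m i) (hm i) (hlm i) (hA i) (hB i)]

/-- the same in `ℤ[X]` with th-6's `P`: **`rank = [t^k] Π_i P_{m_i}(t)`**, `P_m = 2(1+t)^m − 1 − t^m` (FN-1's `[t^k] P_box`). -/
theorem finrank_range_wedge_hankelBox_tpSeq_eq_coeff_P (hn : 1 ≤ n) (hm : ∀ i, 1 ≤ m i) {A B lam mu : Fin n → K}
    (hlm : ∀ i, lam i ≠ mu i) (hA : ∀ i, A i ≠ 0) (hB : ∀ i, B i ≠ 0) (k : ℕ) :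
    (finrank K (LinearMap.range (wedge K (Gen m) k (hankelBox K m fun i => tpSeq K (A i) (B i) (lam i) (mu i)))) : ℤ) =
      (∏ i : Fin n, FormulaN.Uniform.P (m i)).coeff k := by
  rw [finrank_range_wedge_hankelBox_tpSeq K m hn hm hlm hA hB k]
  have h : ∀ i : Fin n, (PairPowers.pairPoly (m i)).map (Nat.castRingHom ℤ) = FormulaN.Uniform.P (m i) := by
    intro i
    ext j
    rw [coeff_map, eq_natCast, PairPowers.coeff_pairPoly_cast]
  rw [← Finset.prod_congr rfl (fun i _ => h i), ← Polynomial.map_prod, coeff_map, eq_natCast]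

/-- the TRANSVERSE-PAIR BOX kernel: `dim ker = C(Σ_i 2m_i, k) − [t^k] Π_i P_{m_i}`. -/
theorem finrank_ker_wedge_hankelBox_tpSeq (hn : 1 ≤ n) (hm : ∀ i, 1 ≤ m i) {A B lam mu : Fin n → K}
    (hlm : ∀ i, lam i ≠ mu i) (hA : ∀ i, A i ≠ 0) (hB : ∀ i, B i ≠ 0) (k : ℕ) :
    finrank K (LinearMap.ker (wedge K (Gen m) k (hankelBox K m fun i => tpSeq K (A i) (B i) (lam i) (mu i)))) =
      (∑ i : Fin n, (m i + m i)).choose k - (∏ i : Fin n, PairPowers.pairPoly (m i)).coeff k := by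
  rw [finrank_ker_wedge_hankelBox K m hn _ k,
    Finset.prod_congr rfl fun i _ => hankelPoly_tpSeq K (m i) (hm i) (hlm i) (hA i) (hB i)]

/-- the two-ended Hankel factor with ITS OWN coefficient pair `(a_i, c_i)` IS th-7's point pair `a_i·E_{X_i} + c_i·E_{Y_i}` embedded
in block `i` (`m_i ≥ 1`). -/
theorem hfac_ppSeq (hm : ∀ i, 1 ≤ m i) (a c : Fin n → K) {i : ℕ} (hi : i < n) :
    hfac K m (fun i => ppSeq K (m i) (a i) (c i)) i =
      emb K (facEmb m ⟨i, hi⟩) (PairPowers.pp K (m ⟨i, hi⟩) (a ⟨i, hi⟩) (c ⟨i, hi⟩)) := by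
  rw [hfac, dif_pos hi, w_ppSeq K _ (hm _)]

/-- **POINT PAIRS WITH PER-FACTOR COEFFICIENT PAIRS `(a_i, c_i)`, all non-zero** (`m_i ≥ 1`):
`rank(θ ↦ θ ∧ Π_i (a_i E_{X_i} + c_i E_{Y_i}) ∣ ⋀^k) = [t^k] Π_i P_{m_i}(t)` — the coefficients are idle factor by factor
(READ-NOTE-p10-g8 «NOT typed: general coefficient pairs», closed for the mixed / iterated model). -/
theorem finrank_range_wedge_hankelBox_ppSeq (hn : 1 ≤ n) (hm : ∀ i, 1 ≤ m i) {a c : Fin n → K}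
    (ha : ∀ i, a i ≠ 0) (hc : ∀ i, c i ≠ 0) (k : ℕ) :
    finrank K (LinearMap.range (wedge K (Gen m) k (hankelBox K m fun i => ppSeq K (m i) (a i) (c i)))) =
      (∏ i : Fin n, PairPowers.pairPoly (m i)).coeff k := by
  rw [finrank_range_wedge_hankelBox K m hn _ k,
    Finset.prod_congr rfl fun i _ => hankelPoly_ppSeq K (m i) (hm i) (ha i) (hc i)]

/-- with ONE coefficient pair `(a, c)` for every factor the two-ended Hankel factors ARE gen 6's point-pair factors `fac`. -/
theorem hfac_ppSeq_eq_fac (hm : ∀ i, 1 ≤ m i) (a c : K) :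
    hfac K m (fun i => ppSeq K (m i) a c) = fac K m a c := by
  funext i
  by_cases hi : i < n
  · rw [hfac, fac, dif_pos hi, dif_pos hi, w_ppSeq K _ (hm _)]
  · rw [hfac, fac, dif_neg hi, dif_neg hi]

/-- **THE MIXED POINT-PAIR BOX IS THE HANKEL BOX OF TWO-ENDED SEQUENCES, ON THE NOSE** (`m_i ≥ 1`): gen 6's
`rankPoly_mixedBox = Π_i P_{m_i}` is the instance «every factor of Hankel rank 2» of the Hankel box law. -/
theorem hankelBox_ppSeq_eq_mixedBox (hm : ∀ i, 1 ≤ m i) (a c : K) :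
    hankelBox K m (fun i => ppSeq K (m i) a c) = mixedBox K m a c := by
  rw [hankelBox, mixedBox, hfac_ppSeq_eq_fac K m hm]

/-- consistency: through the identification, §2 and gen 6 give the same rank polynomial `Π_i P_{m_i}` for the mixed point-pair box
(`a, c ≠ 0`, `m_i ≥ 1`, `n ≥ 1`) — two routes, one number. -/
theorem rankPoly_mixedBox_via_hankelBox (hn : 1 ≤ n) (hm : ∀ i, 1 ≤ m i) {a c : K} (ha : a ≠ 0) (hc : c ≠ 0) :
    rankPoly K (Gen m) Finset.univ (mixedBox K m a c) = ∏ i : Fin n, PairPowers.pairPoly (m i) := by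
  rw [← hankelBox_ppSeq_eq_mixedBox K m hm, rankPoly_hankelBox_fin K m hn,
    Finset.prod_congr rfl fun i _ => hankelPoly_ppSeq K (m i) (hm i) ha hc]

end RankTwoBoxes

end Summit.Ventures.HSemireg.Wedge.HankelBox
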